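import Summits.RiemannHypothesis.RiemannHypothesis.Theorems.MotivicDoorAWSStructure
import Mathlib.LinearAlgebra.BilinearForm.TensorProduct
import Mathlib.LinearAlgebra.TensorProduct.Finiteness
import Mathlib.RingTheory.TensorProduct.Maps

/-!
# AWS plumbing I: base change `L ⊗ ℝ` of the intersection pairing and the Hodge field over `ℝ`

HONEST LABEL (verbatim on every AWS file).  One-way implication from a strengthened, prime-side-only
axiom system; the existence of such an object is NOT claimed and is the located gap; the converse
(RH ⇒ existence) is out of scope and, for this axiom system, tautological rather than informative
(HOME `AXIOM-CONTENT.md` §2; `AWS/Tautological`, `AWS/CanonicalCarrier`; REFEREE-1 B36/B39):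
`Nonempty ArithmeticWeilSurface` is a restatement of RH in structure clothing, NOT evidence for RH.
Framing: lottery ticket at the motivic door; RH probability negligible; consolation
prizes are real: a new semi-local Weil-positivity theorem, or a located gap in the Connes–Consani
programme, plus the ff-door theorem.  Nothing in this file mentions `ζ`, its zeros or
`RiemannHypothesis`: it is linear algebra over the structure `ArithmeticWeilSurface` of
`Theorems/MotivicDoorAWSStructure` (AWS sprint part (d), plumbing; seat aws-1).

## Contents (all PROVED, kernel-checked; no new axioms, no named `Prop` facts)

* **Base change** (generic, `LatticePairing`): for an additive group `L` with a biadditive real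
  pairing `B : L →+ L →+ ℝ`, the `ℝ`-bilinear form `LatticePairing.baseChange B` on `ℝ ⊗[ℤ] L`
  (Mathlib `LinearMap.BilinMap.baseChange` followed by multiplication `ℝ ⊗[ℤ] ℝ → ℝ`),
  `baseChange_tmul : (a ⊗ x, b ⊗ y) ↦ a b B(x,y)`, symmetry, and the integral → real coercion
  `ofLattice : L →+ ℝ ⊗[ℤ] L`, compatible with the pairings, whose real span is everything.
* **The Hodge field as a predicate** `IsHodgeNonpos B e₁ e₂` (the shape of the structure field
  `ArithmeticWeilSurface.hodge`, for abstract data — a predicate with parameters, not a named fact),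
  its extension to arbitrary finite index types, and the constructor-side lemma
  `IsHodgeNonpos.of_primGram` (it follows from nonpositivity of the primitive Gram forms).
* **The surface over `ℝ`**: `X.Lℝ = ℝ ⊗[ℤ] X.L`, `X.interBC`, `X.toLℝ`, the rulings `E₁, E₂`, and
  the TRANSPORT of the field `hodge` (finite real combinations of lattice vectors, design note
  §5(d)) to the genuine statement on `L ⊗ ℝ`: `interBC_self_nonpos_of_perp` (negative
  semidefinite on `⟨E₁,E₂⟩^⊥`); the primitive projection `prim` (an `ℝ`-linear idempotent), the
  polarised decomposition `z·w = prim z·prim w + (z·E₁)(w·E₂) + (z·E₂)(w·E₁)`, Castelnuovo–Severi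
  `z² ≤ 2(z·E₁)(z·E₂)` on all of `L ⊗ ℝ`, and the "ample class" form (nonpositive on `(E₁+E₂)^⊥`).

Sequel files: `AWS/PlumbingSignature` (Cauchy–Schwarz, light cone, radical, Sylvester `sigPos = 1`),
`AWS/PlumbingLevels` (truncation levels, restriction maps, Gram matrices).
References (dictionary only): A. Weil (1948); A. Grothendieck, J. reine angew. Math. 200 (1958);
R. Hartshorne, Algebraic Geometry V.1.9.
(buildfix 2026-08-20: comment-only re-land to re-enqueue the module build after its blocking imports were repaired; no declaration changed.)
-/

noncomputable section

open TensorProduct Literature.NumberTheory.LFunctions Literature.NumberTheory.ConnesConsani2019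
open scoped BigOperators

namespace Summit.RiemannHypothesis.RiemannHypothesis.Theorems.MotivicDoor.AWS

/-! ## 1. Generic base change of a biadditive real pairing on an additive group -/

namespace LatticePairing

variable {L : Type*} [AddCommGroup L] (B : L →+ L →+ ℝ)

/-- A biadditive real pairing as a `ℤ`-bilinear map. -/
def toBilinMapInt : LinearMap.BilinMap ℤ L ℝ :=
  LinearMap.mk₂ ℤ (fun x y ↦ B x y)
    (fun x x' y ↦ by simp only [map_add, AddMonoidHom.add_apply])
    (fun c x y ↦ by simpa only [AddMonoidHom.flip_apply] using map_zsmul (B.flip y) c x)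
    (fun x y y' ↦ by simp only [map_add])
    (fun c x y ↦ by simp only [map_zsmul])

/-- `toBilinMapInt B x y = B x y`. -/
@[simp] theorem toBilinMapInt_apply (x y : L) : toBilinMapInt B x y = B x y := rfl

/-- **Base change of the pairing to `L_ℝ = ℝ ⊗[ℤ] L`**: the `ℝ`-bilinear form
`(a ⊗ x, b ⊗ y) ↦ a b · B(x, y)` (Mathlib's `LinearMap.BilinMap.baseChange`, whose values lie in
`ℝ ⊗[ℤ] ℝ`, followed by the multiplication map `ℝ ⊗[ℤ] ℝ → ℝ`). -/
def baseChange : LinearMap.BilinForm ℝ (ℝ ⊗[ℤ] L) :=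
  ((toBilinMapInt B).baseChange ℝ).compr₂ (Algebra.TensorProduct.lmul'' ℤ (S := ℝ)).toLinearMap

/-- The base-changed form on pure tensors. -/
@[simp] theorem baseChange_tmul (a b : ℝ) (x y : L) :
    baseChange B (a ⊗ₜ[ℤ] x) (b ⊗ₜ[ℤ] y) = a * b * B x y := by
  simp only [baseChange, LinearMap.compr₂_apply, LinearMap.BilinMap.baseChange_tmul,
    toBilinMapInt_apply, AlgHom.toLinearMap_apply]
  change Algebra.TensorProduct.lmul' (S := ℝ) ℤ ((a * b) ⊗ₜ[ℤ] B x y) = _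
  rw [Algebra.TensorProduct.lmul'_apply_tmul]

/-- The base change of a symmetric pairing is symmetric. -/
theorem baseChange_comm (hB : ∀ x y, B x y = B y x) (z w : ℝ ⊗[ℤ] L) :
    baseChange B z w = baseChange B w z := by
  simp only [baseChange, LinearMap.compr₂_apply]
  rw [LinearMap.BilinMap.baseChange_isSymm (fun x y ↦ ?_)]
  simp only [toBilinMapInt_apply, hB]

/-- **Integral → real coercion** `x ↦ 1 ⊗ x : L →+ L_ℝ`. -/
def ofLattice : L →+ ℝ ⊗[ℤ] L := (TensorProduct.mk ℤ ℝ L 1).toAddMonoidHom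

/-- `ofLattice x = 1 ⊗ x`. -/
@[simp] theorem ofLattice_apply (x : L) : ofLattice x = (1 : ℝ) ⊗ₜ[ℤ] x := rfl

/-- `a • (1 ⊗ x) = a ⊗ x`: every pure tensor is a real multiple of an integral class. -/
theorem smul_ofLattice (a : ℝ) (x : L) : a • ofLattice x = a ⊗ₜ[ℤ] x := by
  rw [ofLattice_apply, TensorProduct.smul_tmul', smul_eq_mul, mul_one]

/-- Integral multiples commute with the coercion: `ofLattice (n • x) = (n : ℝ) • ofLattice x`. -/
theorem ofLattice_zsmul (n : ℤ) (x : L) : ofLattice (n • x) = (n : ℝ) • ofLattice (L := L) x := by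
  rw [map_zsmul, ← Int.cast_smul_eq_zsmul ℝ]

/-- **The coercion is compatible with the pairings**: `B_ℝ(1 ⊗ x, 1 ⊗ y) = B(x, y)`. -/
@[simp] theorem baseChange_ofLattice (x y : L) :
    baseChange B (ofLattice x) (ofLattice y) = B x y := by
  simp

/-- Every element of `L_ℝ` is a finite real combination of integral classes. -/
theorem exists_sum_smul_ofLattice (z : ℝ ⊗[ℤ] L) :
    ∃ S : Finset (ℝ × L), z = ∑ i ∈ S, i.1 • ofLattice i.2 := by
  obtain ⟨S, hS⟩ := TensorProduct.exists_finset z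
  exact ⟨S, by simpa only [smul_ofLattice] using hS⟩

/-- The real span of the integral classes is everything. -/
theorem span_range_ofLattice : Submodule.span ℝ (Set.range (ofLattice (L := L))) = ⊤ := by
  rw [eq_top_iff]
  rintro z -
  obtain ⟨S, rfl⟩ := exists_sum_smul_ofLattice z
  exact Submodule.sum_mem _ fun i _ ↦
    Submodule.smul_mem _ _ (Submodule.subset_span (Set.mem_range_self _))

end LatticePairing

/-! ## 2. The shape of the Hodge field, as a predicate on abstract data -/

/-- The Hodge-index sign condition in the shape of the field `ArithmeticWeilSurface.hodge`: the
real-ified pairing is nonpositive on every finite real combination of lattice vectors orthogonal to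
`e₁` and `e₂`. -/
def IsHodgeNonpos {L : Type*} [AddCommGroup L] (B : L →+ L →+ ℝ) (e₁ e₂ : L) : Prop :=
  ∀ (n : ℕ) (v : Fin n → L) (a : Fin n → ℝ),
    (∑ k, a k * B (v k) e₁ = 0) → (∑ k, a k * B (v k) e₂ = 0) →
      ∑ k, ∑ l, a k * a l * B (v k) (v l) ≤ 0

namespace IsHodgeNonpos

variable {L : Type*} [AddCommGroup L] {B : L →+ L →+ ℝ} {e₁ e₂ : L}

/-- The condition for an arbitrary finite index type. -/
theorem fintype (H : IsHodgeNonpos B e₁ e₂) {κ : Type*} [Fintype κ] (v : κ → L) (a : κ → ℝ)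
    (h₁ : ∑ k, a k * B (v k) e₁ = 0) (h₂ : ∑ k, a k * B (v k) e₂ = 0) :
    ∑ k, ∑ l, a k * a l * B (v k) (v l) ≤ 0 := by
  classical
  obtain ⟨n, ⟨e⟩⟩ := Finite.exists_equiv_fin κ
  have hsum : ∀ f : κ → ℝ, ∑ k, f k = ∑ i : Fin n, f (e.symm i) := fun f ↦
    Fintype.sum_equiv e _ _ fun k ↦ by rw [e.symm_apply_apply]
  rw [hsum] at h₁ h₂
  have hre : ∑ k, ∑ l, a k * a l * B (v k) (v l) =
      ∑ i : Fin n, ∑ j : Fin n, a (e.symm i) * a (e.symm j) * B (v (e.symm i)) (v (e.symm j)) := by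
    rw [hsum]
    exact Finset.sum_congr rfl fun i _ ↦ hsum _
  rw [hre]
  exact H n (fun i ↦ v (e.symm i)) (fun i ↦ a (e.symm i)) h₁ h₂

/-- **Constructor side**: the Hodge condition follows from nonpositivity of the PRIMITIVE Gram forms
`Σ a_k a_l (B(v_k,v_l) − B(v_k,e₁)B(v_l,e₂) − B(v_k,e₂)B(v_l,e₁))` on all finite families (no
orthogonality constraint; this is the shape a level-by-level certificate has). -/
theorem of_primGram
    (H : ∀ (n : ℕ) (v : Fin n → L) (a : Fin n → ℝ),
      ∑ k, ∑ l, a k * a l *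
        (B (v k) (v l) - B (v k) e₁ * B (v l) e₂ - B (v k) e₂ * B (v l) e₁) ≤ 0) :
    IsHodgeNonpos B e₁ e₂ := by
  intro n v a h₁ h₂
  have key : ∑ k, ∑ l, a k * a l *
      (B (v k) (v l) - B (v k) e₁ * B (v l) e₂ - B (v k) e₂ * B (v l) e₁) =
      ∑ k, ∑ l, a k * a l * B (v k) (v l) -
        2 * ((∑ k, a k * B (v k) e₁) * (∑ k, a k * B (v k) e₂)) := by
    simp only [mul_sub, Finset.sum_sub_distrib, Finset.sum_mul_sum]
    have h1 : ∑ k, ∑ l, a k * a l * (B (v k) e₁ * B (v l) e₂) =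
        ∑ k, ∑ l, a k * B (v k) e₁ * (a l * B (v l) e₂) :=
      Finset.sum_congr rfl fun k _ ↦ Finset.sum_congr rfl fun l _ ↦ by ring
    have h2 : ∑ k, ∑ l, a k * a l * (B (v k) e₂ * B (v l) e₁) =
        ∑ k, ∑ l, a k * B (v k) e₁ * (a l * B (v l) e₂) := by
      rw [Finset.sum_comm]
      exact Finset.sum_congr rfl fun k _ ↦ Finset.sum_congr rfl fun l _ ↦ by ring
    rw [h1, h2]
    ring
  have := H n v a
  rw [key, h₁, h₂, mul_zero, mul_zero, sub_zero] at this
  exact this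

end IsHodgeNonpos

/-! ## 3. The arithmetic Weil surface over `ℝ` -/

namespace ArithmeticWeilSurface

variable (X : ArithmeticWeilSurface)

/-- The Hodge field of `X` in predicate form. -/
theorem isHodgeNonpos : IsHodgeNonpos X.inter X.e₁ X.e₂ := X.hodge

/-- The Hodge field for an arbitrary finite index type. -/
theorem hodge_fintype {κ : Type*} [Fintype κ] (v : κ → X.L) (a : κ → ℝ)
    (h₁ : ∑ k, a k * X.inter (v k) X.e₁ = 0) (h₂ : ∑ k, a k * X.inter (v k) X.e₂ = 0) :
    ∑ k, ∑ l, a k * a l * X.inter (v k) (v l) ≤ 0 :=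
  X.isHodgeNonpos.fintype v a h₁ h₂

/-- **`L_ℝ = ℝ ⊗[ℤ] L`**, the real vector space of the lattice. -/
abbrev Lℝ : Type := ℝ ⊗[ℤ] X.L

/-- The real intersection form on `L_ℝ` (base change of `X.inter`). -/
def interBC : LinearMap.BilinForm ℝ X.Lℝ := LatticePairing.baseChange X.inter

/-- The integral → real coercion `L →+ L_ℝ`. -/
def toLℝ : X.L →+ X.Lℝ := LatticePairing.ofLattice

/-- `toLℝ x = 1 ⊗ x`. -/
@[simp] theorem toLℝ_apply (x : X.L) : X.toLℝ x = (1 : ℝ) ⊗ₜ[ℤ] x := rfl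

/-- The real form on pure tensors. -/
@[simp] theorem interBC_tmul (a b : ℝ) (x y : X.L) :
    X.interBC (a ⊗ₜ[ℤ] x) (b ⊗ₜ[ℤ] y) = a * b * X.inter x y :=
  LatticePairing.baseChange_tmul X.inter a b x y

/-- **Compatibility of the integral and real forms**: `(1 ⊗ x)·(1 ⊗ y) = x·y`. -/
theorem interBC_toLℝ (x y : X.L) : X.interBC (X.toLℝ x) (X.toLℝ y) = X.inter x y := by simp

/-- `a • toLℝ x = a ⊗ x`. -/
theorem smul_toLℝ (a : ℝ) (x : X.L) : a • X.toLℝ x = a ⊗ₜ[ℤ] x :=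
  LatticePairing.smul_ofLattice a x

/-- The real form is symmetric. -/
theorem interBC_comm (z w : X.Lℝ) : X.interBC z w = X.interBC w z :=
  LatticePairing.baseChange_comm X.inter X.inter_comm z w

/-- The rulings in `L_ℝ`. -/
def E₁ : X.Lℝ := X.toLℝ X.e₁

/-- The rulings in `L_ℝ`. -/
def E₂ : X.Lℝ := X.toLℝ X.e₂

/-- `E₁² = 0`. -/
@[simp] theorem interBC_E₁_E₁ : X.interBC X.E₁ X.E₁ = 0 := by simp [E₁, X.inter_e₁_e₁]
/-- `E₂² = 0`. -/
@[simp] theorem interBC_E₂_E₂ : X.interBC X.E₂ X.E₂ = 0 := by simp [E₂, X.inter_e₂_e₂]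
/-- `E₁·E₂ = 1`. -/
@[simp] theorem interBC_E₁_E₂ : X.interBC X.E₁ X.E₂ = 1 := by simp [E₁, E₂, X.inter_e₁_e₂]
/-- `E₂·E₁ = 1`. -/
@[simp] theorem interBC_E₂_E₁ : X.interBC X.E₂ X.E₁ = 1 := by simp [E₁, E₂, X.inter_e₂_e₁]

/-- `(a ⊗ x)·E₁ = a (x·e₁)`. -/
@[simp] theorem interBC_tmul_E₁ (a : ℝ) (x : X.L) :
    X.interBC (a ⊗ₜ[ℤ] x) X.E₁ = a * X.inter x X.e₁ := by simp [E₁]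

/-- `(a ⊗ x)·E₂ = a (x·e₂)`. -/
@[simp] theorem interBC_tmul_E₂ (a : ℝ) (x : X.L) :
    X.interBC (a ⊗ₜ[ℤ] x) X.E₂ = a * X.inter x X.e₂ := by simp [E₂]

/-- `(E₁ + E₂)² = 2 > 0`: the form has a positive direction. -/
theorem interBC_E₁_add_E₂_self : X.interBC (X.E₁ + X.E₂) (X.E₁ + X.E₂) = 2 := by
  simp only [map_add, LinearMap.add_apply, interBC_E₁_E₁, interBC_E₁_E₂, interBC_E₂_E₁,
    interBC_E₂_E₂]
  norm_num

/-- **The Hodge field on `L ⊗ ℝ`** (design note §5(d): the field, stated on finite real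
combinations of lattice vectors, IS negative semidefiniteness of the base-changed form on
`⟨E₁, E₂⟩^⊥ ⊂ L_ℝ`, because every element of `ℝ ⊗[ℤ] L` is such a combination). -/
theorem interBC_self_nonpos_of_perp (z : X.Lℝ) (h₁ : X.interBC z X.E₁ = 0)
    (h₂ : X.interBC z X.E₂ = 0) : X.interBC z z ≤ 0 := by
  classical
  obtain ⟨S, rfl⟩ := TensorProduct.exists_finset z
  simp only [map_sum, LinearMap.sum_apply, interBC_tmul_E₁, interBC_tmul_E₂, interBC_tmul]
    at h₁ h₂ ⊢
  simp only [← Finset.sum_coe_sort S] at h₁ h₂ ⊢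
  rw [Finset.sum_comm]
  exact X.hodge_fintype (fun i : S ↦ (i : ℝ × X.L).2) (fun i : S ↦ (i : ℝ × X.L).1) h₁ h₂

/-- **The primitive projection** `z ↦ z − (z·E₂) E₁ − (z·E₁) E₂` onto `⟨E₁, E₂⟩^⊥`
(an `ℝ`-linear idempotent). -/
def prim : X.Lℝ →ₗ[ℝ] X.Lℝ :=
  LinearMap.id - (X.interBC.flip X.E₂).smulRight X.E₁ - (X.interBC.flip X.E₁).smulRight X.E₂

/-- `prim z = z − (z·E₂) E₁ − (z·E₁) E₂`. -/
@[simp] theorem prim_apply (z : X.Lℝ) :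
    X.prim z = z - X.interBC z X.E₂ • X.E₁ - X.interBC z X.E₁ • X.E₂ := rfl

/-- `prim z ⊥ E₁`. -/
theorem interBC_prim_E₁ (z : X.Lℝ) : X.interBC (X.prim z) X.E₁ = 0 := by
  simp [map_sub, LinearMap.sub_apply, map_smul, LinearMap.smul_apply]

/-- `prim z ⊥ E₂`. -/
theorem interBC_prim_E₂ (z : X.Lℝ) : X.interBC (X.prim z) X.E₂ = 0 := by
  simp [map_sub, LinearMap.sub_apply, map_smul, LinearMap.smul_apply]

/-- Classes orthogonal to the rulings are their own primitive part. -/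
theorem prim_eq_self_of_perp {z : X.Lℝ} (h₁ : X.interBC z X.E₁ = 0) (h₂ : X.interBC z X.E₂ = 0) :
    X.prim z = z := by
  simp [h₁, h₂]

/-- `prim` is idempotent. -/
theorem prim_prim (z : X.Lℝ) : X.prim (X.prim z) = X.prim z :=
  X.prim_eq_self_of_perp (X.interBC_prim_E₁ z) (X.interBC_prim_E₂ z)

/-- Polarised decomposition `z·w = prim z · prim w + (z·E₁)(w·E₂) + (z·E₂)(w·E₁)`. -/
theorem interBC_eq_prim (z w : X.Lℝ) :
    X.interBC z w = X.interBC (X.prim z) (X.prim w) +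
      X.interBC z X.E₁ * X.interBC w X.E₂ + X.interBC z X.E₂ * X.interBC w X.E₁ := by
  have h1 : X.interBC X.E₁ w = X.interBC w X.E₁ := X.interBC_comm _ _
  have h2 : X.interBC X.E₂ w = X.interBC w X.E₂ := X.interBC_comm _ _
  simp only [prim_apply, map_sub, LinearMap.sub_apply, map_smul, LinearMap.smul_apply, smul_eq_mul,
    interBC_E₁_E₁, interBC_E₁_E₂, interBC_E₂_E₁, interBC_E₂_E₂, h1, h2]
  ring

/-- `z² = (prim z)² + 2 (z·E₁)(z·E₂)`. -/
theorem interBC_self_eq_prim (z : X.Lℝ) :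
    X.interBC z z = X.interBC (X.prim z) (X.prim z) + 2 * (X.interBC z X.E₁ * X.interBC z X.E₂) := by
  rw [X.interBC_eq_prim z z]
  ring

/-- The primitive part of any class has nonpositive square. -/
theorem interBC_prim_self_nonpos (z : X.Lℝ) : X.interBC (X.prim z) (X.prim z) ≤ 0 :=
  X.interBC_self_nonpos_of_perp _ (X.interBC_prim_E₁ z) (X.interBC_prim_E₂ z)

/-- **Castelnuovo–Severi on `L ⊗ ℝ`**: `z² ≤ 2 (z·E₁)(z·E₂)` for every real class. -/
theorem interBC_self_le (z : X.Lℝ) :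
    X.interBC z z ≤ 2 * (X.interBC z X.E₁ * X.interBC z X.E₂) := by
  have h := X.interBC_prim_self_nonpos z
  rw [X.interBC_self_eq_prim z]
  linarith

/-- **Hodge index in the "ample class" form**: the form is nonpositive on `(E₁ + E₂)^⊥`
(indeed `z² = (prim z)² − 2 (z·E₁)²` there). -/
theorem interBC_self_nonpos_of_perp_sum (z : X.Lℝ) (h : X.interBC z (X.E₁ + X.E₂) = 0) :
    X.interBC z z ≤ 0 := by
  have h' : X.interBC z X.E₂ = -X.interBC z X.E₁ := by
    rw [map_add] at h
    linarith
  have hp := X.interBC_prim_self_nonpos z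
  rw [X.interBC_self_eq_prim z, h']
  nlinarith [sq_nonneg (X.interBC z X.E₁)]

end ArithmeticWeilSurface

end Summit.RiemannHypothesis.RiemannHypothesis.Theorems.MotivicDoor.AWS
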